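import Literature.NumberTheory.Automorphic.ChevalleyIrreducible
import Literature.Algebra.Lie.Sl2Strings
import Mathlib.Algebra.Lie.Sl2
import Mathlib.LinearAlgebra.RootSystem.Reduced
import HarnessLib

/-!
# Integrability and finite-dimensionality of `L(Λ)` for dominant `Λ`

Trunk T-AUTOMORPHIC (G25 AutomorphicL); highest-weight theory for Chevalley's existence theorem
(`Literature.NumberTheory.Automorphic.chevalley_existence`, Springer 10.1.1), step 4 after
`ChevalleyIrreducible.lean` (`Irr S lam`, its weight spaces `wspL`). For a Chevalley system `S`
of the reduced root datum `P` with base `b`, over a field `k` of characteristic `0`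
(algebraically closed where the `sl₂`-theory needs it), and `Λ ∈ X`:

* the **simple `sl₂`-triples** `(h_s, e_s, e_{-s})` (`isSl2Triple`; `[e_s, e_{-s}] = h_s` as the
  coordinates of a simple coroot are `δ`, `corootCoord_of_mem_support`);
* for `⟨Λ, α_s^∨⟩ = m ∈ ℕ`, the **singular vector `e_{-s}^{m+1} v_Λ` of `M(Λ)` is killed by every
  positive root vector** (`lie_e_fIter_succ_of_isPos`: Mathlib's primitive-vector identity for
  `e_s`, and `[e_β, e_{-s}] ∈ k e_{β-α_s}` with `2α_s` not a root for `β ≠ α_s`) and **lies in the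
  maximal submodule** (`fIter_succ_mem_maxSub`: PBW monomials either kill it or lower its
  degree), so **`e_{-s}^{m+1} v̄_Λ = 0` in `L(Λ)`** (`fIterL_succ_eq_zero`);
* **local finiteness** of `L(Λ)` under the triple of `s` for `Λ` dominant integral at `s`: the
  sum of the *good pieces* (finite-dimensional, triple-stable, spanned by weight vectors) is
  `L`-stable and contains the string of `v̄_Λ`, hence is everything (`goodSup_eq_top`,
  `exists_isGoodPiece_mem`; Humphreys 21.2);
* an **`sl₂` fact** (`Sl2Aux.F_pow_apply_ne_zero`): in a finite-dimensional module with
  diagonalisable `H`, a weight vector `v ≠ 0` of weight `p ∈ ℕ` has `F^p v ≠ 0` (from the Casimir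
  blocks of the tree's `Literature/Algebra/Lie/Sl2Strings.lean`);
* hence **the weights of `L(Λ)` are stable under the simple reflections** (`wspL_reflect_ne_bot`,
  `reflection_mem_wtSet`), so by `RootDatumWeights.finite_of_forall_reflection_mem` **`L(Λ)` has
  finitely many weights** (`wtSet_finite`) and **is finite-dimensional for dominant `Λ`**
  (`finiteDimensional_irr`; Humphreys Theorem 21.2); also `Λ - α_s` is a weight when
  `⟨Λ, α_s^∨⟩ > 0` (`fIterL_one_ne_zero`).

Everything is proved; statements are [folklore] (Humphreys, *Introduction to Lie Algebras*,
§7.2, §20.2, §21.1–21.2). Nothing here is in Mathlib (no highest weight modules) or elsewhere in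
the tree (`lean search`).
-/

noncomputable section

open Set Function Finsupp UniversalEnvelopingAlgebra LieModule
open Literature.Algebra.Lie.PBW

attribute [local instance 100] LieRing.ofAssociativeRing

namespace Literature.NumberTheory.Automorphic

/-! ### An `sl₂` fact: `F^p v ≠ 0` for a weight vector `v ≠ 0` of weight `p ∈ ℕ` -/

namespace Sl2Aux

open Literature.Algebra.Lie.Sl2 Module

variable {k : Type*} [Field k] {V : Type*} [AddCommGroup V] [Module k V]
variable {H E F : Module.End k V}

/-- **In a finite-dimensional module over an `sl₂`-triple of endomorphisms with diagonalisable
`H` (algebraically closed field of characteristic `0`), a non-zero vector of `H`-weight `p ∈ ℕ`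
is not killed by `F^p`.** Proof through the Casimir blocks of the tree's
`Literature/Algebra/Lie/Sl2Strings.lean`: the component of `v` in the block of parameter `m` has
weight `p = m - 2j` and is `F^j w` for a top vector `w`, and `F^{p+j} w ≠ 0` as `p + j ≤ m`
(complete reducibility of `sl₂`-modules, Humphreys §7.2). [folklore] -/
theorem F_pow_apply_ne_zero [CharZero k] [IsAlgClosed k] [FiniteDimensional k V]
    (t : IsSl2Triple H E F) (hdiag : ⨆ μ : k, wsp H μ = ⊤) {p : ℕ} {v : V}
    (hv : v ∈ wsp H (p : k)) (hv0 : v ≠ 0) : (F ^ p) v ≠ 0 := by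
  classical
  intro hF
  apply hv0
  set W : Submodule k V := wsp H (p : k) with hWdef
  -- decompose `v` along the Casimir blocks inside `W`
  have hW : ∀ x ∈ W, casimir H E F x ∈ W := fun x hx => casimir_apply_mem t hx
  have hCtop : ⨆ c : k, block H E F c = ⊤ := Module.End.iSup_maxGenEigenspace_eq_top _
  have hdec : W = ⨆ c : k, W ⊓ block H E F c := by
    have h1 := Submodule.inf_iSup_genEigenspace (p := W) (f := casimir H E F) hW ⊤
    rw [show (⨆ μ : k, (casimir H E F).genEigenspace μ ⊤) = ⊤ from hCtop, inf_top_eq] at h1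
    exact h1
  have hv' : v ∈ ⨆ c : k, W ⊓ block H E F c := by rw [← hdec]; exact hv
  obtain ⟨g, hg, hsum⟩ := (Submodule.mem_iSup_iff_exists_finsupp _ _).1 hv'
  suffices hall : ∀ c ∈ g.support, g c = 0 by
    rw [← hsum, Finsupp.sum, Finset.sum_eq_zero hall]
  intro c hc
  by_contra hgc
  have hgW : g c ∈ W := (Submodule.mem_inf.1 (hg c)).1
  have hgB : g c ∈ block H E F c := (Submodule.mem_inf.1 (hg c)).2
  -- `F^p (g c) = 0`: it lies in the block of `c` and in the sum of the other blocks
  have hother : (F ^ p) (v - g c) ∈ ⨆ c' ≠ c, block H E F c' := by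
    have hvg : v - g c = ∑ c' ∈ g.support.erase c, g c' := by
      rw [← hsum, Finsupp.sum, Finset.sum_erase_eq_sub hc]
    rw [hvg, map_sum]
    refine Submodule.sum_mem _ fun c' hc' => ?_
    exact Submodule.mem_iSup_of_mem c' (Submodule.mem_iSup_of_mem (Finset.ne_of_mem_erase hc')
      (apply_F_pow_mem_block t hdiag (Submodule.mem_inf.1 (hg c')).2 p))
  have hFg : (F ^ p) (g c) = 0 := by
    have hmem1 : (F ^ p) (g c) ∈ block H E F c := apply_F_pow_mem_block t hdiag hgB p
    have hmem2 : (F ^ p) (g c) ∈ ⨆ c' ≠ c, block H E F c' := by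
      have heq : (F ^ p) (g c) = (F ^ p) v - (F ^ p) (v - g c) := by rw [map_sub, sub_sub_cancel]
      rw [heq, hF, zero_sub]
      exact Submodule.neg_mem _ hother
    exact (Submodule.disjoint_def.1 (iSupIndep_def.1 (casimir H E F).independent_maxGenEigenspace c))
      _ hmem1 hmem2
  -- the block structure
  have hcne : block H E F c ≠ ⊥ := fun h0 => hgc (by rw [h0, Submodule.mem_bot] at hgB; exact hgB)
  obtain ⟨m, hcm⟩ := exists_nat_of_block_ne_bot t hdiag hcne
  obtain ⟨j, hjm, hpj⟩ := exists_weight_eq t hdiag hcm hgB hgW hgc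
  have hpj' : p + 2 * j = m := by
    have h1 : ((p + 2 * j : ℕ) : k) = m := by push_cast; rw [hpj]; ring
    exact_mod_cast h1
  have hpiece : g c ∈ piece H E F c m j := Submodule.mem_inf.2 ⟨hgB, by rw [← hpj]; exact hgW⟩
  obtain ⟨w, hw, hwj⟩ := exists_F_pow_eq t hdiag hcm hjm hpiece
  have hFw : (F ^ (p + j)) w = 0 := by rw [pow_add, Module.End.mul_apply, hwj, hFg]
  have hwtop : w ∈ wsp H (m : k) := by have := (Submodule.mem_inf.1 hw).2; simpa using this
  have hw0 : w = 0 :=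
    eq_zero_of_F_pow_eq_zero t hdiag hcm (by omega) (Submodule.mem_inf.1 hw).1 hwtop hFw
  rw [hw0, map_zero] at hwj
  exact hgc hwj.symm

/-- Coercion of powers of a restricted endomorphism. [folklore] -/
lemma coe_restrict_pow_apply {f : Module.End k V} {U : Submodule k V} (hf : ∀ x ∈ U, f x ∈ U)
    (n : ℕ) (u : U) : (((f.restrict hf) ^ n) u : V) = (f ^ n) (u : V) := by
  induction n generalizing u with
  | zero => simp
  | succ n ih => rw [pow_succ, Module.End.mul_apply, ih, LinearMap.coe_restrict_apply, pow_succ,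
      Module.End.mul_apply]

end Sl2Aux

namespace ChevalleyVerma

variable {k : Type*} [Field k]
variable {ι X Y : Type*} [AddCommGroup X] [AddCommGroup Y] [Fintype ι] [DecidableEq ι]
variable {P : RootPairing ι ℤ X Y} {b : P.Base}

/-! ### The simple `sl₂`-triples of a Chevalley system -/

/-- The index `-s` of the negative of the simple root `α_s`. [folklore] -/
abbrev negIdx (s : b.support) : ι := P.reflectionPerm s s

omit [Fintype ι] [DecidableEq ι] in
/-- `α_{-s} = -α_s`. [folklore] -/
lemma root_negIdx (s : b.support) : P.root (negIdx s) = -P.root (s : ι) := by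
  rw [negIdx, P.root_reflectionPerm, P.reflection_apply_self]

omit [Fintype ι] [DecidableEq ι] in
/-- `⟨α_{-s}, α_s^∨⟩ = -2`. [folklore] -/
lemma pairing_negIdx (s : b.support) : P.pairing (negIdx s) s = -2 := by
  rw [RootPairing.pairing, RootPairing.root', root_negIdx, map_neg, LinearMap.neg_apply]
  change -(P.pairing s s) = -2
  rw [P.pairing_same]

omit [Fintype ι] [DecidableEq ι] in
/-- **The coordinates of a simple coroot are `δ_{s t}`.** [folklore] -/
theorem corootCoord_of_mem_support (s : b.support) : corootCoord P b s = Finsupp.single s 1 := by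
  have h := (linearIndependent_coroot_support P b).repr_eq_single s
    ⟨P.coroot s, coroot_mem_span_simple P b s⟩ rfl
  exact h

/-! ### Degrees of PBW words -/

/-- The `X`-degree of a PBW index: `0` for Cartan indices, `α` for the root index `α`. [folklore] -/
def idxRoot (b : P.Base) : PBWIdx b → X := Sum.elim (fun _ => 0) fun i => P.root i

omit [DecidableEq ι] in
/-- The total degree of a word in Cartan and negative root vectors pairs non-positively with
`2ρ^∨`. [folklore] -/
lemma toLinearMap_sum_idxRoot_nonpos [P.IsReduced] (l : List (PBWIdx b))
    (hl : ∀ y ∈ l, PBWIdx.cls y ≠ 2) :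
    P.toLinearMap ((l.map (idxRoot b)).sum) b.twoRhoCoroot ≤ 0 := by
  induction l with
  | nil => simp
  | cons y l ih =>
    rw [List.map_cons, List.sum_cons, map_add, LinearMap.add_apply]
    have h1 := ih fun z hz => hl z (List.mem_cons_of_mem _ hz)
    have hy := hl y List.mem_cons_self
    suffices h0 : P.toLinearMap (idxRoot b y) b.twoRhoCoroot ≤ 0 by linarith
    cases y with
    | inl t => simp [idxRoot]
    | inr i =>
      have hneg : ¬ b.IsPos i := fun hpos => hy (PBWIdx.cls_root_of_isPos hpos)
      change P.toLinearMap (P.root i) b.twoRhoCoroot ≤ 0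
      have h2 : P.root' i b.twoRhoCoroot = 2 * b.height i := b.root'_twoRhoCoroot i
      change P.root' i b.twoRhoCoroot ≤ 0
      rw [h2]
      rw [RootPairing.Base.isPos_iff] at hneg
      omega

omit [DecidableEq ι] in
/-- Entries of the sorted list of the class-`c` part have class `c`. [folklore] -/
lemma cls_of_mem_sort_part (c : Fin 3) (m : PBWIdx b →₀ ℕ) {y : PBWIdx b}
    (hy : y ∈ Multiset.sort (toMultiset (part c m))) : PBWIdx.cls y = c := by
  rw [Multiset.mem_sort, Finsupp.mem_toMultiset] at hy
  exact cls_eq_of_mem_support_part hy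

/-- Stability of a span under a bracket, from the generators. [folklore] -/
lemma lie_mem_span_of_forall {L : Type*} [LieRing L] [LieAlgebra k L] {M : Type*} [AddCommGroup M]
    [Module k M] [LieRingModule L M] [LieModule k L M] (G : Set M) (x : L) (hG : ∀ g ∈ G, ⁅x, g⁆ ∈ Submodule.span k G) :
    ∀ u ∈ Submodule.span k G, ⁅x, u⁆ ∈ Submodule.span k G := by
  intro u hu
  induction hu using Submodule.span_induction with
  | mem g hg => exact hG g hg
  | zero => rw [lie_zero]; exact Submodule.zero_mem _
  | add u v _ _ hu hv => rw [lie_add]; exact Submodule.add_mem _ hu hv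
  | smul c u _ hu => rw [lie_smul]; exact Submodule.smul_mem _ c hu

section System

variable {L : Type*} [LieRing L] [LieAlgebra k L] {h : b.support → L} {e : ι → L}
  (S : IsChevalleySystem P b k h e)

local notation "𝓤" => UniversalEnvelopingAlgebra k L
local notation "ιU" => UniversalEnvelopingAlgebra.ι k (L := L)

include S

omit [Fintype ι] [DecidableEq ι] in
/-- `h_s ≠ 0`. [folklore] -/
lemma h_ne_zero (s : b.support) : h s ≠ 0 := by
  have := S.linearIndependent.ne_zero (Sum.inl s)
  simpa using this

omit [Fintype ι] [DecidableEq ι] in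
/-- **`[e_s, e_{-s}] = h_s` for a simple root.** [folklore] -/
theorem lie_e_e_negIdx (s : b.support) : ⁅e s, e (negIdx s)⁆ = h s := by
  rw [negIdx, S.lie_e_neg, corootCoord_of_mem_support]
  rw [Finset.sum_eq_single s (fun t _ hts => by rw [Finsupp.single_eq_of_ne hts, Int.cast_zero, zero_smul])
    (fun hs => absurd (Finset.mem_univ s) hs), Finsupp.single_eq_same, Int.cast_one, one_smul]

omit [Fintype ι] [DecidableEq ι] in
/-- `[h_s, e_s] = 2 e_s`. [folklore] -/
lemma lie_h_e_self (s : b.support) : ⁅h s, e s⁆ = 2 • e s := by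
  rw [S.lie_h_e, P.pairing_same, Int.cast_two, two_smul, two_nsmul]

omit [Fintype ι] [DecidableEq ι] in
/-- `[h_s, e_{-s}] = -2 e_{-s}`. [folklore] -/
lemma lie_h_e_negIdx (s : b.support) : ⁅h s, e (negIdx s)⁆ = -(2 • e (negIdx s)) := by
  rw [S.lie_h_e, pairing_negIdx, Int.cast_neg, Int.cast_two, neg_smul, two_smul, two_nsmul]

omit [Fintype ι] [DecidableEq ι] in
/-- **`(h_s, e_s, e_{-s})` is an `sl₂`-triple** (Mathlib `IsSl2Triple`). [folklore] -/
theorem isSl2Triple (s : b.support) : IsSl2Triple (h s) (e s) (e (negIdx s)) where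
  h_ne_zero := h_ne_zero S s
  lie_e_f := lie_e_e_negIdx S s
  lie_h_e_nsmul := lie_h_e_self S s
  lie_h_f_nsmul := lie_h_e_negIdx S s

/-! ### The singular vectors `e_{-s}^{m+1} v_Λ` of `M(Λ)` for dominant integral `Λ` -/

section Dominant

variable [CharZero k] (Λ : X)

omit [CharZero k] in
/-- For `⟨Λ, α_s^∨⟩ = m ∈ ℕ`, **`v_Λ` is a primitive vector of weight `m` for the triple of `s`.**
[folklore] -/
theorem hasPrimitiveVectorWith_hwv (s : b.support) {m : ℕ} (hm : P.toLinearMap Λ (P.coroot s) = m) :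
    (isSl2Triple S s).HasPrimitiveVectorWith (hwv S (xChar b k Λ)) (m : k) where
  ne_zero := hwv_ne_zero S _
  lie_h := by rw [lie_h_hwv S, xChar_apply, hm, Int.cast_natCast]
  lie_e := lie_e_hwv_of_isPos S _ (b.isPos_of_mem_support s.2)

/-- The iterates `e_{-s}^j v_Λ`. [folklore] -/
def fIter (s : b.support) (j : ℕ) : Verma S (xChar b k Λ) :=
  ((toEnd k L (Verma S (xChar b k Λ)) (e (negIdx s))) ^ j) (hwv S (xChar b k Λ))

omit [Fintype ι] [DecidableEq ι] [CharZero k] in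
/-- `fIter s 0 = v_Λ`. [folklore] -/
@[simp] lemma fIter_zero (s : b.support) : fIter S Λ s 0 = hwv S (xChar b k Λ) := by
  simp [fIter]

omit [Fintype ι] [DecidableEq ι] [CharZero k] in
/-- `fIter s (j+1) = e_{-s} (fIter s j)`. [folklore] -/
lemma fIter_succ (s : b.support) (j : ℕ) : fIter S Λ s (j + 1) = ⁅e (negIdx s), fIter S Λ s j⁆ := by
  rw [fIter, fIter, pow_succ', Module.End.mul_apply, toEnd_apply_apply]

/-- **`e_{-s}^j v_Λ` has degree `j α_{-s} = -j α_s`.** [folklore] -/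
theorem fIter_mem_wsp [Module.Finite ℤ X] (s : b.support) (j : ℕ) :
    fIter S Λ s j ∈ wsp S (xChar b k Λ) (j • P.root (negIdx s)) := by
  induction j with
  | zero => rw [fIter_zero, zero_smul]; exact hwv_mem_wsp S _
  | succ j ih =>
    rw [fIter_succ, add_smul, one_smul]
    have hx : j • P.root (negIdx s) ∈ P.rootSpan ℤ :=
      Submodule.smul_of_tower_mem _ j (Submodule.subset_span (mem_range_self _))
    exact lie_e_mem_wsp S (xChar b k Λ) (x := j • P.root (negIdx s)) hx ih (negIdx s)

omit [CharZero k] in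
/-- **`e_s` kills the singular vector**: `e_s e_{-s}^{m+1} v_Λ = 0` for `⟨Λ, α_s^∨⟩ = m`
(Mathlib `IsSl2Triple.HasPrimitiveVectorWith.lie_e_pow_succ_toEnd_f`). [folklore] -/
theorem lie_e_self_fIter_succ (s : b.support) {m : ℕ} (hm : P.toLinearMap Λ (P.coroot s) = m) :
    ⁅e s, fIter S Λ s (m + 1)⁆ = 0 := by
  have hP := (hasPrimitiveVectorWith_hwv S Λ s hm).lie_e_pow_succ_toEnd_f m
  rw [sub_self, mul_zero, zero_smul] at hP
  exact hP

omit [DecidableEq ι] [CharZero k] in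
/-- **The other positive root vectors kill all `e_{-s}^j v_Λ`**: `e_β e_{-s}^j v_Λ = 0` for
`β > 0`, `β ≠ α_s` (induction on `j`: `[e_β, e_{-s}]` is a multiple of `e_{β - α_s}`, again
positive and `≠ α_s` as `2α_s` is not a root, or zero). [folklore] -/
theorem lie_e_fIter_of_ne [P.IsReduced] (s : b.support) (j : ℕ) :
    ∀ {i : ι}, b.IsPos i → i ≠ s → ⁅e i, fIter S Λ s j⁆ = 0 := by
  have : Module.IsReflexive ℤ X := .of_isPerfPair P.toLinearMap
  have : IsAddTorsionFree X := .of_isTorsionFree ℤ X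
  induction j with
  | zero =>
    intro i hi _
    rw [fIter_zero]
    exact lie_e_hwv_of_isPos S _ hi
  | succ j ih =>
    intro i hi his
    rw [fIter_succ, leibniz_lie, ih hi his, lie_zero, add_zero]
    by_cases hex : ∃ l, P.root i + P.root (negIdx s) = P.root l
    · obtain ⟨l, hl⟩ := hex
      obtain ⟨t, -, ht⟩ := S.exists_lie_e_e_eq_smul i (negIdx s) l hl
      -- `l` is positive and `≠ s`
      have hlpos : b.IsPos l := by
        have hh := b.height_add hl.symm
        have hh2 : b.height (negIdx s) = -b.height (s : ι) := by
          letI := P.indexNeg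
          exact b.height_reflectionPerm_self s
        rw [hh2, b.height_one_of_mem_support s.2] at hh
        rw [RootPairing.Base.isPos_iff] at hi ⊢
        have := b.height_ne_zero l
        omega
      have hls : l ≠ s := by
        intro hls
        rw [hls, root_negIdx, ← sub_eq_add_neg, sub_eq_iff_eq_add, ← two_smul ℕ] at hl
        exact P.nsmul_notMem_range_root (n := 2) (i := (s : ι)) ⟨i, hl⟩
      rw [ht, smul_lie, ih hlpos hls, smul_zero]
    · have hne : P.root i + P.root (negIdx s) ≠ 0 := by
        rw [root_negIdx, ← sub_eq_add_neg, sub_ne_zero]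
        exact fun heq => his (P.root.injective heq)
      rw [S.lie_e_e_eq_zero i (negIdx s) hne (fun ⟨l, hl⟩ => hex ⟨l, hl.symm⟩), zero_lie]

omit [CharZero k] in
/-- **All positive root vectors kill the singular vector `e_{-s}^{m+1} v_Λ`.** [folklore] -/
theorem lie_e_fIter_succ_of_isPos [P.IsReduced] (s : b.support) {m : ℕ}
    (hm : P.toLinearMap Λ (P.coroot s) = m) {i : ι} (hi : b.IsPos i) :
    ⁅e i, fIter S Λ s (m + 1)⁆ = 0 := by
  by_cases his : i = s
  · subst his; exact lie_e_self_fIter_succ S Λ s hm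
  · exact lie_e_fIter_of_ne S Λ s (m + 1) hi his

/-! ### Words of `U(L)` acting on weight vectors -/

/-- **A PBW word maps `M(λ)_x` into `M(λ)_{x + ∑ deg}`.** [folklore] -/
theorem word_smul_mem_wsp [Module.Finite ℤ X] (lam : b.support → k) (l : List (PBWIdx b)) {x : X}
    (hx : x ∈ P.rootSpan ℤ) {v : Verma S lam} (hv : v ∈ wsp S lam x) :
    word (basisPBW S) l • v ∈ wsp S lam (x + (l.map (idxRoot b)).sum) := by
  induction l with
  | nil => simpa using hv
  | cons y l ih =>
    have hsum : (l.map (idxRoot b)).sum ∈ P.rootSpan ℤ := by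
      refine list_sum_mem fun z hz => ?_
      obtain ⟨y', -, rfl⟩ := List.mem_map.1 hz
      cases y' with
      | inl t => exact Submodule.zero_mem _
      | inr i => exact Submodule.subset_span (mem_range_self i)
    rw [word_cons, mul_smul, List.map_cons, List.sum_cons,
      show x + (idxRoot b y + (l.map (idxRoot b)).sum) = (x + (l.map (idxRoot b)).sum) + idxRoot b y by abel]
    change ⁅basisPBW S y, word (basisPBW S) l • v⁆ ∈ _
    cases y with
    | inl t =>
      change ⁅basisPBW S (PBWIdx.cartan t), _⁆ ∈ wsp S lam (x + (l.map (idxRoot b)).sum + 0)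
      rw [basisPBW_cartan, add_zero, lie_h_of_mem_wsp S lam ih t]
      exact Submodule.smul_mem _ _ ih
    | inr i =>
      change ⁅basisPBW S (PBWIdx.root i), _⁆ ∈ wsp S lam (x + (l.map (idxRoot b)).sum + P.root i)
      rw [basisPBW_root]
      exact lie_e_mem_wsp S lam (Submodule.add_mem _ hx hsum) ih i

omit [CharZero k] in
/-- A word in the Cartan vectors acts by a scalar on a weight vector. [folklore] -/
lemma exists_word_cartan_smul_eq (lam : b.support → k) (l : List (PBWIdx b))
    (hl : ∀ y ∈ l, PBWIdx.cls y = 1) {x : X} {v : Verma S lam} (hv : v ∈ wsp S lam x) :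
    ∃ c : k, word (basisPBW S) l • v = c • v := by
  induction l with
  | nil => exact ⟨1, by simp⟩
  | cons y l ih =>
    obtain ⟨c, hc⟩ := ih fun z hz => hl z (List.mem_cons_of_mem _ hz)
    obtain ⟨t, rfl⟩ := exists_eq_cartan_of_cls_eq_one (hl y List.mem_cons_self)
    refine ⟨(lam t + xChar b k x t) * c, ?_⟩
    rw [word_cons, mul_smul, hc, basisPBW_cartan]
    change ⁅h t, c • v⁆ = _
    rw [lie_smul, lie_h_of_mem_wsp S lam hv t, smul_smul, mul_comm]

omit [CharZero k] [Fintype ι] [DecidableEq ι] in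
/-- A non-empty word in positive root vectors kills a vector killed by all positive root
vectors. [folklore] -/
lemma word_pos_smul_eq_zero (lam : b.support → k) (l : List (PBWIdx b))
    (hl : ∀ y ∈ l, PBWIdx.cls y = 2) (hne : l ≠ []) {w : Verma S lam}
    (hw : ∀ i, b.IsPos i → ⁅e i, w⁆ = 0) : word (basisPBW S) l • w = 0 := by
  induction l with
  | nil => exact absurd rfl hne
  | cons y l ih =>
    obtain ⟨i, hi, rfl⟩ := exists_eq_root_of_cls_eq_two (hl y List.mem_cons_self)
    rw [word_cons, mul_smul, basisPBW_root]
    by_cases hl0 : l = []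
    · subst hl0
      rw [word_nil, one_smul]
      exact hw i hi
    · rw [ih (fun z hz => hl z (List.mem_cons_of_mem _ hz)) hl0, smul_zero]

omit [CharZero k] in
/-- The `v_λ`-coordinate of a vector of non-zero degree vanishes. [folklore] -/
lemma hwCoord_eq_zero_of_mem_wsp (lam : b.support → k) {x : X} (hx : x ≠ 0) {v : Verma S lam}
    (hv : v ∈ wsp S lam x) : hwCoord S lam v = 0 := by
  by_contra hne
  exact hx (((mem_wsp_iff S lam x v).1 hv 0 hne).symm.trans rootSum_zero)

/-- **The singular vector `e_{-s}^{m+1} v_Λ` lies in the maximal submodule `N(Λ)`** for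
`⟨Λ, α_s^∨⟩ = m ∈ ℕ`: every PBW monomial `x^{n⁻} x^{n⁰} x^{n⁺}` applied to it is either `0`
(`n⁺ ≠ 0`: the positive root vectors kill it) or a vector of negative degree (`n⁺ = 0`), in
either case with zero `v_Λ`-coordinate (Humphreys §21.2, proof of Theorem 21.2, step (1);
§20.2). [folklore] -/
theorem fIter_succ_mem_maxSub [P.IsReduced] [Module.Finite ℤ X] (s : b.support) {m : ℕ}
    (hm : P.toLinearMap Λ (P.coroot s) = m) :
    fIter S Λ s (m + 1) ∈ maxSub S (xChar b k Λ) := by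
  set w := fIter S Λ s (m + 1) with hwdef
  have hwpos : ∀ i, b.IsPos i → ⁅e i, w⁆ = 0 := fun i hi => lie_e_fIter_succ_of_isPos S Λ s hm hi
  have hwdeg := fIter_mem_wsp S Λ s (m + 1)
  have hdegmem : (m + 1) • P.root (negIdx s) ∈ P.rootSpan ℤ :=
    Submodule.smul_of_tower_mem _ _ (Submodule.subset_span (mem_range_self _))
  -- it suffices to treat PBW monomials
  suffices hmon : ∀ n : PBWIdx b →₀ ℕ,
      hwCoord S (xChar b k Λ) (ordMonomial (basisPBW S) n • w) = 0 by
    intro u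
    have hu : u ∈ Submodule.span k (Set.range (ordMonomial (basisPBW S))) := by
      rw [span_ordMonomial_eq_top]; exact Submodule.mem_top
    induction hu using Submodule.span_induction with
    | mem u hu => obtain ⟨n, rfl⟩ := hu; exact hmon n
    | zero => rw [zero_smul, map_zero]
    | add u u' _ _ hu hu' => rw [add_smul, map_add, hu, hu', add_zero]
    | smul c u _ hu => rw [smul_assoc, map_smul, hu, smul_zero]
  intro n
  rw [ordMonomial_eq_parts S n, mul_smul, mul_smul]
  by_cases h2 : part 2 n = 0
  · -- no positive part: a Cartan scalar, then a negative word lowers the degree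
    rw [h2, ordMonomial_zero, one_smul]
    obtain ⟨c, hc⟩ := exists_word_cartan_smul_eq S (xChar b k Λ) (Multiset.sort (toMultiset (part 1 n)))
      (fun y hy => cls_of_mem_sort_part 1 n hy) hwdeg
    rw [ordMonomial, ordMonomial, hc, smul_algebra_smul_comm, map_smul]
    have hmem := word_smul_mem_wsp S (xChar b k Λ) (Multiset.sort (toMultiset (part 0 n))) hdegmem hwdeg
    suffices h0 : hwCoord S (xChar b k Λ) (word (basisPBW S) (Multiset.sort (toMultiset (part 0 n))) • w) = 0 by
      rw [h0, smul_zero]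
    refine hwCoord_eq_zero_of_mem_wsp S _ (fun hdeg => ?_) hmem
    -- the degree is non-zero: it pairs negatively with `2ρ^∨`
    have hle := toLinearMap_sum_idxRoot_nonpos (b := b) (Multiset.sort (toMultiset (part 0 n)))
      (fun y hy => by rw [cls_of_mem_sort_part 0 n hy]; decide)
    have hneg : P.toLinearMap ((m + 1) • P.root (negIdx s)) b.twoRhoCoroot = -(2 * (m + 1 : ℤ)) := by
      rw [map_nsmul, LinearMap.smul_apply]
      have h1 : P.root' (negIdx s) b.twoRhoCoroot = 2 * b.height (negIdx s) := b.root'_twoRhoCoroot _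
      have h2' : b.height (negIdx s) = -b.height (s : ι) := by
        letI := P.indexNeg
        exact b.height_reflectionPerm_self s
      change (m + 1) • P.root' (negIdx s) b.twoRhoCoroot = _
      rw [h1, h2', b.height_one_of_mem_support s.2, nsmul_eq_mul]
      push_cast
      ring
    have := congrArg (fun y => P.toLinearMap y b.twoRhoCoroot) hdeg
    simp only [map_add, LinearMap.add_apply, map_zero, LinearMap.zero_apply] at this
    rw [hneg] at this
    have hm0 : (0 : ℤ) ≤ m := Int.natCast_nonneg m
    linarith
  · -- a positive part kills `w`
    have hne : Multiset.sort (toMultiset (part 2 n)) ≠ [] := by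
      obtain ⟨y, hy⟩ := Finsupp.support_nonempty_iff.2 h2
      exact List.ne_nil_of_mem ((Multiset.mem_sort _).2 ((Finsupp.mem_toMultiset _ _).2 hy))
    rw [show ordMonomial (basisPBW S) (part 2 n) • w = 0 from
      word_pos_smul_eq_zero S _ _ (fun y hy => cls_of_mem_sort_part 2 n hy) hne hwpos,
      smul_zero, smul_zero, map_zero]

/-! ### Consequences in `L(Λ)` -/

/-- The iterates `e_{-s}^j v̄_Λ` in `L(Λ)`. [folklore] -/
def fIterL (s : b.support) (j : ℕ) : Irr S (xChar b k Λ) :=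
  ((toEnd k L (Irr S (xChar b k Λ)) (e (negIdx s))) ^ j) (hwvL S (xChar b k Λ))

omit [CharZero k] in
/-- `fIterL s 0 = v̄_Λ`. [folklore] -/
@[simp] lemma fIterL_zero (s : b.support) : fIterL S Λ s 0 = hwvL S (xChar b k Λ) := by
  simp [fIterL]

omit [CharZero k] in
/-- `fIterL s (j+1) = e_{-s} (fIterL s j)`. [folklore] -/
lemma fIterL_succ (s : b.support) (j : ℕ) : fIterL S Λ s (j + 1) = ⁅e (negIdx s), fIterL S Λ s j⁆ := by
  rw [fIterL, fIterL, pow_succ', Module.End.mul_apply, toEnd_apply_apply]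

omit [CharZero k] in
/-- `fIterL` is the image of `fIter`. [folklore] -/
lemma mkL_fIter (s : b.support) (j : ℕ) : mkL S _ (fIter S Λ s j) = fIterL S Λ s j := by
  induction j with
  | zero => rw [fIter_zero, fIterL_zero, hwvL]
  | succ j ih => rw [fIter_succ, fIterL_succ, ← ih, lie_mkL]

/-- **`e_{-s}^{m+1} v̄_Λ = 0` in `L(Λ)`** for `⟨Λ, α_s^∨⟩ = m ∈ ℕ` (Humphreys 21.2, step (1)).
[folklore] -/
theorem fIterL_succ_eq_zero [P.IsReduced] [Module.Finite ℤ X] (s : b.support) {m : ℕ}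
    (hm : P.toLinearMap Λ (P.coroot s) = m) : fIterL S Λ s (m + 1) = 0 := by
  rw [← mkL_fIter, mkL_eq_zero_iff]
  exact fIter_succ_mem_maxSub S Λ s hm

/-- `e_{-s}^j v̄_Λ ∈ L(Λ)_{j α_{-s}}`. [folklore] -/
theorem fIterL_mem_wspL [Module.Finite ℤ X] (s : b.support) (j : ℕ) :
    fIterL S Λ s j ∈ wspL S (xChar b k Λ) (j • P.root (negIdx s)) := by
  rw [← mkL_fIter]
  exact mkL_mem_wspL S _ (fIter_mem_wsp S Λ s j)

omit [CharZero k] in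
/-- **`v̄_Λ` is a primitive vector of `L(Λ)` of weight `m = ⟨Λ, α_s^∨⟩`.** [folklore] -/
theorem hasPrimitiveVectorWith_hwvL (s : b.support) {m : ℕ} (hm : P.toLinearMap Λ (P.coroot s) = m) :
    (isSl2Triple S s).HasPrimitiveVectorWith (hwvL S (xChar b k Λ)) (m : k) where
  ne_zero := hwvL_ne_zero S _
  lie_h := by rw [lie_h_hwvL S, xChar_apply, hm, Int.cast_natCast]
  lie_e := lie_e_hwvL_of_isPos S _ (b.isPos_of_mem_support s.2)

omit [CharZero k] in
/-- `e_s (fIterL s (j+1)) = (j+1)(m-j) fIterL s j`. [folklore] -/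
theorem lie_e_self_fIterL_succ (s : b.support) {m : ℕ} (hm : P.toLinearMap Λ (P.coroot s) = m) (j : ℕ) :
    ⁅e s, fIterL S Λ s (j + 1)⁆ = ((j + 1) * ((m : k) - j)) • fIterL S Λ s j :=
  (hasPrimitiveVectorWith_hwvL S Λ s hm).lie_e_pow_succ_toEnd_f j

/-- **`e_{-s} v̄_Λ ≠ 0` when `⟨Λ, α_s^∨⟩ = m > 0`** (`e_s e_{-s} v̄_Λ = m v̄_Λ`). [folklore] -/
theorem fIterL_one_ne_zero (s : b.support) {m : ℕ} (hm : P.toLinearMap Λ (P.coroot s) = m)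
    (hm0 : 0 < m) : fIterL S Λ s 1 ≠ 0 := by
  intro h0
  have h1 := lie_e_self_fIterL_succ S Λ s hm 0
  rw [zero_add, h0, lie_zero] at h1
  simp only [Nat.cast_zero, zero_add, sub_zero, one_mul, fIterL_zero] at h1
  exact hwvL_ne_zero S _ ((smul_eq_zero.1 h1.symm).resolve_left (Nat.cast_ne_zero.2 hm0.ne'))

/-! ### Local finiteness of `L(Λ)` under the simple triples -/

section LocalFinite

variable [Module.Finite ℤ X] [P.IsReduced]

/-- **A good piece** of `L(Λ)` for the simple root `α_s`: a finite-dimensional `k`-subspace,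
stable under `e_s, e_{-s}, h_s`, and spanned by its weight vectors. [folklore] -/
structure IsGoodPiece (s : b.support) (U : Submodule k (Irr S (xChar b k Λ))) : Prop where
  /-- finite-dimensional -/
  finiteDimensional : FiniteDimensional k U
  /-- stable under the triple -/
  lie_mem : ∀ x ∈ ({e s, e (negIdx s), h s} : Set L), ∀ u ∈ U, ⁅x, u⁆ ∈ U
  /-- spanned by its weight vectors -/
  graded : U ≤ ⨆ y : X, U ⊓ wspL S (xChar b k Λ) y

omit [CharZero k] [Module.Finite ℤ X] [P.IsReduced] in
/-- `⊥` is a good piece. [folklore] -/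
lemma isGoodPiece_bot (s : b.support) : IsGoodPiece S Λ s ⊥ where
  finiteDimensional := inferInstance
  lie_mem := fun x _ u hu => by rw [(Submodule.mem_bot k).1 hu, lie_zero]; exact Submodule.zero_mem _
  graded := bot_le

omit [CharZero k] [Module.Finite ℤ X] [P.IsReduced] in
/-- The sup of two good pieces is good. [folklore] -/
lemma IsGoodPiece.sup {s : b.support} {U U' : Submodule k (Irr S (xChar b k Λ))}
    (hU : IsGoodPiece S Λ s U) (hU' : IsGoodPiece S Λ s U') : IsGoodPiece S Λ s (U ⊔ U') where
  finiteDimensional := by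
    haveI := hU.finiteDimensional; haveI := hU'.finiteDimensional
    exact Submodule.finiteDimensional_sup U U'
  lie_mem := fun x hx w hw => by
    obtain ⟨u, hu, u', hu', rfl⟩ := Submodule.mem_sup.1 hw
    rw [lie_add]
    exact Submodule.add_mem _ (Submodule.mem_sup_left (hU.lie_mem x hx u hu))
      (Submodule.mem_sup_right (hU'.lie_mem x hx u' hu'))
  graded := by
    refine sup_le (hU.graded.trans ?_) (hU'.graded.trans ?_)
    · exact iSup_mono fun y => inf_le_inf_right _ le_sup_left
    · exact iSup_mono fun y => inf_le_inf_right _ le_sup_right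

omit [CharZero k] [Module.Finite ℤ X] [P.IsReduced] in
/-- A finite sup of good pieces is good. [folklore] -/
lemma isGoodPiece_finsetSup {s : b.support} {α : Type*} (F : Finset α)
    (U : α → Submodule k (Irr S (xChar b k Λ))) (hU : ∀ a ∈ F, IsGoodPiece S Λ s (U a)) :
    IsGoodPiece S Λ s (F.sup U) := by
  classical
  induction F using Finset.induction_on with
  | empty => rw [Finset.sup_empty]; exact isGoodPiece_bot S Λ s
  | insert a F ha ih =>
    rw [Finset.sup_insert]
    exact (hU a (Finset.mem_insert_self a F)).sup S Λ
      (ih fun a' ha' => hU a' (Finset.mem_insert_of_mem ha'))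

/-- **The `L`-closure step `U + ∑_j b_j • U`** of a subspace (`b_j` the basis `(h_s, e_α)` of
`L`). [folklore] -/
def lieStep (U : Submodule k (Irr S (xChar b k Λ))) : Submodule k (Irr S (xChar b k Λ)) :=
  U ⊔ ⨆ j : b.support ⊕ ι, U.map (toEnd k L (Irr S (xChar b k Λ)) (S.basis j))

omit [CharZero k] [Module.Finite ℤ X] [P.IsReduced] in
/-- `U ≤ lieStep U`. [folklore] -/
lemma le_lieStep (U : Submodule k (Irr S (xChar b k Λ))) : U ≤ lieStep S Λ U := le_sup_left

omit [CharZero k] [Module.Finite ℤ X] [P.IsReduced] in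
/-- `⁅b_j, u⁆ ∈ lieStep U` for `u ∈ U`. [folklore] -/
lemma lie_basis_mem_lieStep {U : Submodule k (Irr S (xChar b k Λ))} (j : b.support ⊕ ι) {u}
    (hu : u ∈ U) : ⁅S.basis j, u⁆ ∈ lieStep S Λ U :=
  Submodule.mem_sup_right (Submodule.mem_iSup_of_mem j ⟨u, hu, rfl⟩)

omit [CharZero k] [Module.Finite ℤ X] [P.IsReduced] in
/-- **`⁅x, u⁆ ∈ lieStep U` for every `x ∈ L` and `u ∈ U`.** [folklore] -/
theorem lie_mem_lieStep {U : Submodule k (Irr S (xChar b k Λ))} (x : L) {u} (hu : u ∈ U) :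
    ⁅x, u⁆ ∈ lieStep S Λ U := by
  rw [← S.basis.sum_repr x, sum_lie]
  refine Submodule.sum_mem _ fun j _ => ?_
  rw [smul_lie]
  exact Submodule.smul_mem _ _ (lie_basis_mem_lieStep S Λ j hu)

omit [P.IsReduced] in
/-- **The `L`-closure step of a good piece is a good piece.** [folklore] -/
theorem isGoodPiece_lieStep {s : b.support} {U : Submodule k (Irr S (xChar b k Λ))}
    (hU : IsGoodPiece S Λ s U) : IsGoodPiece S Λ s (lieStep S Λ U) where
  finiteDimensional := by
    haveI := hU.finiteDimensional
    haveI : ∀ j : b.support ⊕ ι, FiniteDimensional k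
        (U.map (toEnd k L (Irr S (xChar b k Λ)) (S.basis j))) := fun j => Module.Finite.map _ _
    haveI : FiniteDimensional k
        (⨆ j : b.support ⊕ ι, U.map (toEnd k L (Irr S (xChar b k Λ)) (S.basis j)) :) :=
      Submodule.finiteDimensional_iSup _
    exact Submodule.finiteDimensional_sup _ _
  lie_mem := by
    intro x hx w hw
    obtain ⟨u, hu, w', hw', rfl⟩ := Submodule.mem_sup.1 hw
    rw [lie_add]
    refine Submodule.add_mem _ (le_lieStep S Λ U (hU.lie_mem x hx u hu)) ?_
    refine Submodule.iSup_induction _ (motive := fun w' => ⁅x, w'⁆ ∈ lieStep S Λ U) hw' ?_ ?_ ?_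
    · rintro j _ ⟨u, hu, rfl⟩
      rw [toEnd_apply_apply, leibniz_lie]
      exact Submodule.add_mem _ (lie_mem_lieStep S Λ _ hu)
        (lie_basis_mem_lieStep S Λ j (hU.lie_mem x hx u hu))
    · rw [lie_zero]; exact Submodule.zero_mem _
    · intro w₁ w₂ h₁ h₂; rw [lie_add]; exact Submodule.add_mem _ h₁ h₂
  graded := by
    refine sup_le (hU.graded.trans (iSup_mono fun y => inf_le_inf_right _ (le_lieStep S Λ U)))
      (iSup_le fun j => ?_)
    rw [Submodule.map_le_iff_le_comap]
    intro u hu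
    rw [Submodule.mem_comap]
    refine Submodule.iSup_induction _
      (motive := fun u => toEnd k L (Irr S (xChar b k Λ)) (S.basis j) u ∈
        ⨆ y : X, lieStep S Λ U ⊓ wspL S (xChar b k Λ) y) (hU.graded hu) ?_ ?_ ?_
    · intro y u hmem
      obtain ⟨huU, huy⟩ := Submodule.mem_inf.1 hmem
      rw [toEnd_apply_apply]
      by_cases hy : y ∈ P.rootSpan ℤ
      · obtain ⟨y', -, hy'⟩ := lie_basis_mem_wspL S (xChar b k Λ) hy huy j
        exact Submodule.mem_iSup_of_mem y' (Submodule.mem_inf.2 ⟨lie_basis_mem_lieStep S Λ j huU, hy'⟩)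
      · rw [wspL_eq_bot_of_notMem S _ hy, Submodule.mem_bot] at huy
        rw [huy, lie_zero]
        exact Submodule.zero_mem _
    · rw [map_zero]; exact Submodule.zero_mem _
    · intro u₁ u₂ h₁ h₂; rw [map_add]; exact Submodule.add_mem _ h₁ h₂

/-- **The string `span {e_{-s}^j v̄_Λ : j ≤ m}` is a good piece** containing `v̄_Λ`
(`⟨Λ, α_s^∨⟩ = m`). [folklore] -/
def strPiece (s : b.support) (m : ℕ) : Submodule k (Irr S (xChar b k Λ)) :=
  Submodule.span k (Set.range fun j : Fin (m + 1) => fIterL S Λ s j)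

omit [Module.Finite ℤ X] [P.IsReduced] [CharZero k] in
/-- `v̄_Λ` lies in the string piece. [folklore] -/
lemma hwvL_mem_strPiece (s : b.support) (m : ℕ) : hwvL S (xChar b k Λ) ∈ strPiece S Λ s m :=
  Submodule.subset_span ⟨0, by simp⟩

omit [CharZero k] [Module.Finite ℤ X] [P.IsReduced] in
/-- `e_{-s}^j v̄_Λ` lies in the string piece for `j ≤ m`. [folklore] -/
lemma fIterL_mem_strPiece (s : b.support) {m j : ℕ} (hj : j ≤ m) :
    fIterL S Λ s j ∈ strPiece S Λ s m :=
  Submodule.subset_span ⟨⟨j, Nat.lt_succ_of_le hj⟩, rfl⟩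

/-- The string piece is good. [folklore] -/
theorem isGoodPiece_strPiece (s : b.support) {m : ℕ} (hm : P.toLinearMap Λ (P.coroot s) = m) :
    IsGoodPiece S Λ s (strPiece S Λ s m) where
  finiteDimensional := FiniteDimensional.span_of_finite k (Set.finite_range _)
  lie_mem := by
    intro x hx
    refine lie_mem_span_of_forall (k := k) _ x ?_
    rintro _ ⟨j, rfl⟩
    change ⁅x, fIterL S Λ s (j : ℕ)⁆ ∈ strPiece S Λ s m
    simp only [Set.mem_insert_iff, Set.mem_singleton_iff] at hx
    rcases hx with rfl | rfl | rfl
    · -- `e_s`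
      rcases Nat.eq_zero_or_eq_succ_pred (j : ℕ) with h0 | hsucc
      · rw [h0, fIterL_zero, lie_e_hwvL_of_isPos S _ (b.isPos_of_mem_support s.2)]
        exact Submodule.zero_mem _
      · rw [hsucc, lie_e_self_fIterL_succ S Λ s hm]
        exact Submodule.smul_mem _ _ (fIterL_mem_strPiece S Λ s (by have := j.2; omega))
    · -- `e_{-s}`
      rw [← fIterL_succ]
      by_cases hj : (j : ℕ) + 1 ≤ m
      · exact fIterL_mem_strPiece S Λ s hj
      · have hjm : (j : ℕ) = m := by have := j.2; omega
        rw [hjm, fIterL_succ_eq_zero S Λ s hm]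
        exact Submodule.zero_mem _
    · -- `h_s`
      rw [lie_h_of_mem_wspL S _ (fIterL_mem_wspL S Λ s j) s]
      exact Submodule.smul_mem _ _ (fIterL_mem_strPiece S Λ s (Nat.le_of_lt_succ j.2))
  graded := by
    refine Submodule.span_le.2 ?_
    rintro _ ⟨j, rfl⟩
    exact Submodule.mem_iSup_of_mem ((j : ℕ) • P.root (negIdx s))
      ⟨fIterL_mem_strPiece S Λ s (Nat.le_of_lt_succ j.2), fIterL_mem_wspL S Λ s j⟩

/-- The sum of all good pieces. [folklore] -/
def goodSup (s : b.support) : Submodule k (Irr S (xChar b k Λ)) :=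
  ⨆ U : {U : Submodule k (Irr S (xChar b k Λ)) // IsGoodPiece S Λ s U}, U.1

omit [CharZero k] [Module.Finite ℤ X] [P.IsReduced] in
/-- A good piece lies in `goodSup`. [folklore] -/
lemma le_goodSup {s : b.support} {U : Submodule k (Irr S (xChar b k Λ))} (hU : IsGoodPiece S Λ s U) :
    U ≤ goodSup S Λ s :=
  le_iSup (fun U : {U : Submodule k (Irr S (xChar b k Λ)) // IsGoodPiece S Λ s U} => U.1) ⟨U, hU⟩

omit [P.IsReduced] in
/-- **The sum of the good pieces is `L`-stable.** [folklore] -/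
theorem lie_mem_goodSup (s : b.support) (x : L) {v : Irr S (xChar b k Λ)} (hv : v ∈ goodSup S Λ s) :
    ⁅x, v⁆ ∈ goodSup S Λ s := by
  refine Submodule.iSup_induction _ (motive := fun v => ⁅x, v⁆ ∈ goodSup S Λ s) hv ?_ ?_ ?_
  · rintro ⟨U, hU⟩ v hv
    exact le_goodSup S Λ (isGoodPiece_lieStep S Λ hU) (lie_mem_lieStep S Λ x hv)
  · rw [lie_zero]; exact Submodule.zero_mem _
  · intro v w hv hw; rw [lie_add]; exact Submodule.add_mem _ hv hw

/-- **The good pieces exhaust `L(Λ)`** for dominant integral `Λ` at `s` (`L(Λ)` is irreducible and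
the non-zero string piece of `v̄_Λ` is good): `L(Λ)` is locally finite under the triple of `s`
(Humphreys 21.2, steps (3)–(4)). [folklore] -/
theorem goodSup_eq_top (s : b.support) {m : ℕ} (hm : P.toLinearMap Λ (P.coroot s) = m) :
    goodSup S Λ s = ⊤ := by
  rcases eq_bot_or_eq_top_of_forall_lie_mem S _ (goodSup S Λ s)
    (fun x v hv => lie_mem_goodSup S Λ s x hv) with h0 | h1
  · exfalso
    have hmem : hwvL S (xChar b k Λ) ∈ goodSup S Λ s :=
      le_goodSup S Λ (isGoodPiece_strPiece S Λ s hm) (hwvL_mem_strPiece S Λ s m)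
    rw [h0, Submodule.mem_bot] at hmem
    exact hwvL_ne_zero S _ hmem
  · exact h1

/-- **Every vector of `L(Λ)` lies in a good piece** (for `Λ` dominant integral at `s`).
[folklore] -/
theorem exists_isGoodPiece_mem (s : b.support) {m : ℕ} (hm : P.toLinearMap Λ (P.coroot s) = m)
    (v : Irr S (xChar b k Λ)) : ∃ U, IsGoodPiece S Λ s U ∧ v ∈ U := by
  classical
  have hv : v ∈ goodSup S Λ s := by rw [goodSup_eq_top S Λ s hm]; exact Submodule.mem_top
  obtain ⟨f, hf, hsum⟩ := (Submodule.mem_iSup_iff_exists_finsupp _ _).1 hv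
  refine ⟨f.support.sup fun U => U.1, isGoodPiece_finsetSup S Λ f.support _ fun U _ => U.2, ?_⟩
  rw [← hsum]
  refine Submodule.sum_mem _ fun U hU => ?_
  have hle : U.1 ≤ f.support.sup fun U => U.1 :=
    Finset.le_sup (f := fun U : {U : Submodule k (Irr S (xChar b k Λ)) // IsGoodPiece S Λ s U} => U.1) hU
  exact hle (hf U)

/-! ### The triple of `s` on a good piece; reflection stability of the weights -/

section Piece

open Literature.Algebra.Lie

variable {s : b.support} {U : Submodule k (Irr S (xChar b k Λ))} (hU : IsGoodPiece S Λ s U)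
include hU

/-- `h_s` restricted to a good piece. [folklore] -/
def resH : Module.End k U :=
  (toEnd k L (Irr S (xChar b k Λ)) (h s)).restrict fun u hu => hU.lie_mem (h s) (by simp) u hu

/-- `e_s` restricted to a good piece. [folklore] -/
def resE : Module.End k U :=
  (toEnd k L (Irr S (xChar b k Λ)) (e s)).restrict fun u hu => hU.lie_mem (e s) (by simp) u hu

/-- `e_{-s}` restricted to a good piece. [folklore] -/
def resF : Module.End k U :=
  (toEnd k L (Irr S (xChar b k Λ)) (e (negIdx s))).restrict
    fun u hu => hU.lie_mem (e (negIdx s)) (by simp) u hu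

omit [CharZero k] [Module.Finite ℤ X] [P.IsReduced] in
/-- Values of `resH`. [folklore] -/
@[simp] lemma coe_resH_apply (u : U) : (resH S Λ hU u : Irr S (xChar b k Λ)) = ⁅h s, (u : Irr S _)⁆ := rfl

omit [CharZero k] [Module.Finite ℤ X] [P.IsReduced] in
/-- Values of `resE`. [folklore] -/
@[simp] lemma coe_resE_apply (u : U) : (resE S Λ hU u : Irr S (xChar b k Λ)) = ⁅e s, (u : Irr S _)⁆ := rfl

omit [CharZero k] [Module.Finite ℤ X] [P.IsReduced] in
/-- Values of `resF`. [folklore] -/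
@[simp] lemma coe_resF_apply (u : U) :
    (resF S Λ hU u : Irr S (xChar b k Λ)) = ⁅e (negIdx s), (u : Irr S _)⁆ := rfl

omit [CharZero k] [Module.Finite ℤ X] [P.IsReduced] in
/-- **The restricted triple is an `sl₂`-triple of endomorphisms** (when `h_s` is non-zero on the
piece). [folklore] -/
theorem isSl2Triple_res (hH : resH S Λ hU ≠ 0) : IsSl2Triple (resH S Λ hU) (resE S Λ hU) (resF S Λ hU) where
  h_ne_zero := hH
  lie_e_f := by
    refine LinearMap.ext fun u => Subtype.ext ?_
    rw [LieRing.of_associative_ring_bracket, LinearMap.sub_apply, Module.End.mul_apply,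
      Module.End.mul_apply, Submodule.coe_sub, coe_resE_apply, coe_resF_apply, coe_resF_apply,
      coe_resE_apply, coe_resH_apply, ← lie_lie, lie_e_e_negIdx S s]
  lie_h_e_nsmul := by
    refine LinearMap.ext fun u => Subtype.ext ?_
    rw [LieRing.of_associative_ring_bracket, LinearMap.sub_apply, Module.End.mul_apply,
      Module.End.mul_apply, Submodule.coe_sub, coe_resH_apply, coe_resE_apply, coe_resE_apply,
      coe_resH_apply, ← lie_lie, lie_h_e_self S s, two_nsmul, add_lie, two_nsmul,
      LinearMap.add_apply, Submodule.coe_add, coe_resE_apply]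
  lie_h_f_nsmul := by
    refine LinearMap.ext fun u => Subtype.ext ?_
    rw [LieRing.of_associative_ring_bracket, LinearMap.sub_apply, Module.End.mul_apply,
      Module.End.mul_apply, Submodule.coe_sub, coe_resH_apply, coe_resF_apply, coe_resF_apply,
      coe_resH_apply, ← lie_lie, lie_h_e_negIdx S s, neg_lie, two_nsmul, add_lie, two_nsmul,
      LinearMap.neg_apply, LinearMap.add_apply, Submodule.coe_neg, Submodule.coe_add, coe_resF_apply]

omit [CharZero k] [Module.Finite ℤ X] [P.IsReduced] in
/-- A weight vector of the piece is an eigenvector of `resH`. [folklore] -/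
lemma resH_apply_of_mem_wspL {y : X} (u : U) (hu : (u : Irr S (xChar b k Λ)) ∈ wspL S (xChar b k Λ) y) :
    resH S Λ hU u = (xChar b k Λ s + xChar b k y s) • u :=
  Subtype.ext (by rw [coe_resH_apply, lie_h_of_mem_wspL S _ hu s, Submodule.coe_smul])

omit [CharZero k] [Module.Finite ℤ X] [P.IsReduced] in
/-- **`resH` is diagonalisable on a good piece** (the piece is spanned by weight vectors).
[folklore] -/
theorem iSup_wsp_resH_eq_top : ⨆ μ : k, Sl2.wsp (resH S Λ hU) μ = ⊤ := by
  rw [eq_top_iff]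
  rintro u -
  -- transport through `U.subtype`
  suffices hsuff : (u : Irr S (xChar b k Λ)) ∈ (⨆ μ : k, Sl2.wsp (resH S Λ hU) μ).map U.subtype by
    obtain ⟨u', hu', heq⟩ := hsuff
    rw [Submodule.subtype_apply] at heq
    rwa [← Subtype.ext heq]
  refine Submodule.iSup_induction _
    (motive := fun x => x ∈ (⨆ μ : k, Sl2.wsp (resH S Λ hU) μ).map U.subtype) (hU.graded u.2) ?_ ?_ ?_
  · intro y x hx
    obtain ⟨hxU, hxy⟩ := Submodule.mem_inf.1 hx
    refine ⟨⟨x, hxU⟩, ?_, rfl⟩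
    refine Submodule.mem_iSup_of_mem (xChar b k Λ s + xChar b k y s) ?_
    rw [Sl2.mem_wsp_iff]
    exact resH_apply_of_mem_wspL S Λ hU ⟨x, hxU⟩ hxy
  · exact Submodule.zero_mem _
  · intro x x' hx hx'; exact Submodule.add_mem _ hx hx'

end Piece

omit [P.IsReduced] in
/-- Iterating `e_α` from `L(Λ)_y` lands in `L(Λ)_{y + p α}`. [folklore] -/
lemma toEnd_pow_mem_wspL (i : ι) {y : X} (hy : y ∈ P.rootSpan ℤ) {v : Irr S (xChar b k Λ)}
    (hv : v ∈ wspL S (xChar b k Λ) y) (p : ℕ) :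
    ((toEnd k L (Irr S (xChar b k Λ)) (e i)) ^ p) v ∈ wspL S (xChar b k Λ) (y + p • P.root i) := by
  induction p with
  | zero => simpa using hv
  | succ p ih =>
    rw [pow_succ', Module.End.mul_apply, toEnd_apply_apply, add_smul, one_smul, ← add_assoc]
    exact lie_e_mem_wspL S _ (Submodule.add_mem _ hy
      (Submodule.smul_of_tower_mem _ p (Submodule.subset_span (mem_range_self i)))) ih i

open Literature.Algebra.Lie in
/-- **The weights of `L(Λ)` are stable under the simple reflection `s_s`** (for `Λ` dominant
integral at `s`): if `L(Λ)_y ≠ 0` then `L(Λ)_{y - ⟨Λ + y, α_s^∨⟩ α_s} ≠ 0`. A non-zero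
`v ∈ L(Λ)_y` lies in a good piece `U` (local finiteness); for `q = ⟨Λ + y, α_s^∨⟩ ≥ 0`,
`e_{-s}^q v ≠ 0` by the `sl₂` fact on `U`, for `q < 0`, `e_s^{-q} v ≠ 0` by the same fact for the
opposite triple (Humphreys 21.2, steps (5)–(7)). [folklore] -/
theorem wspL_reflect_ne_bot [IsAlgClosed k] (s : b.support) {m : ℕ} (hm : P.toLinearMap Λ (P.coroot s) = m)
    {y : X} (hyQ : y ∈ P.rootSpan ℤ) (hy : wspL S (xChar b k Λ) y ≠ ⊥) :
    wspL S (xChar b k Λ) (y - (P.toLinearMap (Λ + y) (P.coroot s)) • P.root s) ≠ ⊥ := by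
  obtain ⟨v, hv, hv0⟩ := (Submodule.ne_bot_iff _).1 hy
  obtain ⟨U, hU, hvU⟩ := exists_isGoodPiece_mem S Λ s hm v
  haveI := hU.finiteDimensional
  set q : ℤ := P.toLinearMap (Λ + y) (P.coroot s) with hq
  have hqk : xChar b k Λ s + xChar b k y s = (q : k) := by
    rw [hq, map_add, LinearMap.add_apply, Int.cast_add, xChar_apply, xChar_apply]
  have heig : resH S Λ hU ⟨v, hvU⟩ = (q : k) • ⟨v, hvU⟩ := by
    rw [resH_apply_of_mem_wspL S Λ hU ⟨v, hvU⟩ hv, hqk]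
  have hvU0 : (⟨v, hvU⟩ : U) ≠ 0 := fun h0 => hv0 (congrArg Subtype.val h0)
  -- if `h_s` vanishes on the piece, `q = 0`
  by_cases hH : resH S Λ hU = 0
  · have hq0 : q = 0 := by
      rw [hH, LinearMap.zero_apply, eq_comm, smul_eq_zero] at heig
      exact_mod_cast heig.resolve_right hvU0
    rw [hq0, zero_smul, sub_zero]
    exact hy
  have t := isSl2Triple_res S Λ hU hH
  have hdiag := iSup_wsp_resH_eq_top S Λ hU
  rcases le_or_gt 0 q with hq0 | hq0
  · -- `q ≥ 0`: `e_{-s}^q v ≠ 0` of degree `y - q α_s`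
    obtain ⟨p, hp⟩ := Int.eq_ofNat_of_zero_le hq0
    have hvw : (⟨v, hvU⟩ : U) ∈ Sl2.wsp (resH S Λ hU) (p : k) := by
      rw [Sl2.mem_wsp_iff, heig, hp, Int.cast_natCast]
    have hne := Sl2Aux.F_pow_apply_ne_zero t hdiag hvw hvU0
    have hmem := toEnd_pow_mem_wspL S Λ (negIdx s) hyQ hv p
    rw [root_negIdx, smul_neg, ← sub_eq_add_neg] at hmem
    rw [hp, Nat.cast_smul_eq_nsmul]
    refine (Submodule.ne_bot_iff _).2 ⟨_, hmem, fun h0 => hne (Subtype.ext ?_)⟩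
    rw [resF, Sl2Aux.coe_restrict_pow_apply, Submodule.coe_zero]
    exact h0
  · -- `q < 0`: `e_s^{-q} v ≠ 0` of degree `y - q α_s`, with the opposite triple
    obtain ⟨p, hp⟩ := Int.exists_eq_neg_ofNat hq0.le
    have hvw : (⟨v, hvU⟩ : U) ∈ Sl2.wsp (-resH S Λ hU) (p : k) := by
      rw [Sl2.mem_wsp_neg_iff, Sl2.mem_wsp_iff, heig, hp, Int.cast_neg, Int.cast_natCast]
    have hne := Sl2Aux.F_pow_apply_ne_zero t.symm (Sl2.hdiag_neg hdiag) hvw hvU0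
    have hmem := toEnd_pow_mem_wspL S Λ s hyQ hv p
    rw [hp, neg_smul, sub_neg_eq_add, Nat.cast_smul_eq_nsmul]
    refine (Submodule.ne_bot_iff _).2 ⟨_, hmem, fun h0 => hne (Subtype.ext ?_)⟩
    rw [resE, Sl2Aux.coe_restrict_pow_apply, Submodule.coe_zero]
    exact h0

/-! ### Finiteness of the weights; `L(Λ)` is finite-dimensional -/

omit [Fintype ι] [DecidableEq ι] [Module.Finite ℤ X] [CharZero k] S [P.IsReduced] in
/-- A negative root is `-`(an `ℕ`-combination of the simple roots). [folklore] -/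
lemma exists_root_eq_neg_sum_nat_of_not_isPos {i : ι} (hi : ¬ b.IsPos i) :
    ∃ f : ι → ℕ, P.root i = -∑ j ∈ b.support, f j • P.root j := by
  obtain ⟨f, -, hf | hf⟩ := b.exists_root_eq_sum_nat_or_neg i
  · exfalso
    have hh := b.height_eq_sum (f := fun j => (f j : ℤ)) (i := i)
      (by rw [hf]; exact Finset.sum_congr rfl fun j _ => (Nat.cast_smul_eq_nsmul ℤ _ _).symm)
    apply hi
    rw [RootPairing.Base.isPos_iff, hh]
    have h0 : (0 : ℤ) ≤ ∑ j ∈ b.support, (f j : ℤ) := Finset.sum_nonneg fun j _ => Int.natCast_nonneg _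
    have hne := b.height_ne_zero i
    rw [hh] at hne
    omega
  · exact ⟨f, hf⟩

omit [Fintype ι] [DecidableEq ι] [Module.Finite ℤ X] [CharZero k] S [P.IsReduced] in
/-- **Degrees of `M(Λ)` are `-`(`ℕ`-combinations of simple roots).** [folklore] -/
lemma exists_rootSum_eq_neg_sum (n : NegRoot b →₀ ℕ) :
    ∃ d : b.support → ℕ, rootSum b n = -∑ t : b.support, d t • P.root (t : ι) := by
  classical
  induction n using Finsupp.induction with
  | zero => exact ⟨0, by simp⟩
  | single_add i c n _ _ ih =>
    obtain ⟨d, hd⟩ := ih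
    obtain ⟨f, hf⟩ := exists_root_eq_neg_sum_nat_of_not_isPos (b := b) i.2
    refine ⟨fun t => c * f t + d t, ?_⟩
    rw [rootSum_add, rootSum_single, hd, hf, smul_neg, ← neg_add, Finset.smul_sum,
      ← Finset.sum_coe_sort b.support, ← Finset.sum_add_distrib]
    congr 1
    refine Finset.sum_congr rfl fun t _ => ?_
    rw [add_smul, smul_smul]

/-- The weights of `L(Λ)`: the `μ ∈ X` with `L(Λ)_{μ - Λ} ≠ 0`. [folklore] -/
def wtSet : Set X := {μ | wspL S (xChar b k Λ) (μ - Λ) ≠ ⊥}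

omit [P.IsReduced] [CharZero k] [Module.Finite ℤ X] in
/-- Membership in `wtSet`. [folklore] -/
lemma mem_wtSet_iff (μ : X) : μ ∈ wtSet S Λ ↔ wspL S (xChar b k Λ) (μ - Λ) ≠ ⊥ := Iff.rfl

omit [P.IsReduced] [CharZero k] [Module.Finite ℤ X] in
/-- `Λ` is a weight. [folklore] -/
lemma self_mem_wtSet : Λ ∈ wtSet S Λ := by
  rw [mem_wtSet_iff, sub_self]
  exact (Submodule.ne_bot_iff _).2 ⟨_, hwvL_mem_wspL S _, hwvL_ne_zero S _⟩

omit [P.IsReduced] [CharZero k] [Module.Finite ℤ X] in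
/-- A non-zero weight space comes from a multi-index. [folklore] -/
lemma exists_rootSum_eq_of_wspL_ne_bot {y : X} (hy : wspL S (xChar b k Λ) y ≠ ⊥) :
    ∃ n : NegRoot b →₀ ℕ, rootSum b n = y := by
  by_contra hne
  push Not at hne
  apply hy
  rw [wspL, wsp, show {n : NegRoot b →₀ ℕ | rootSum b n = y} = ∅ from
    Set.eq_empty_of_forall_notMem fun n hn => hne n hn, Set.image_empty, Submodule.span_empty,
    Submodule.map_bot]

omit [CharZero k] [Module.Finite ℤ X] [P.IsReduced] in
/-- **Weights of `L(Λ)` have the form `Λ - ∑ d_s α_s`, `d_s ∈ ℕ`.** [folklore] -/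
theorem exists_eq_sub_of_mem_wtSet {μ : X} (hμ : μ ∈ wtSet S Λ) :
    ∃ d : b.support → ℕ, μ = Λ - ∑ s : b.support, d s • P.root (s : ι) := by
  obtain ⟨n, hn⟩ := exists_rootSum_eq_of_wspL_ne_bot S Λ hμ
  obtain ⟨d, hd⟩ := exists_rootSum_eq_neg_sum (b := b) n
  refine ⟨d, ?_⟩
  rw [sub_eq_add_neg, ← hd, hn, add_sub_cancel]

/-- **The weights of `L(Λ)` are stable under the simple reflections** (`Λ` dominant).
[folklore] -/
theorem reflection_mem_wtSet [IsAlgClosed k] (hdom : RootDatumWeights.IsDominant P b Λ)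
    {s : ι} (hs : s ∈ b.support) {μ : X} (hμ : μ ∈ wtSet S Λ) : P.reflection s μ ∈ wtSet S Λ := by
  have hyQ : μ - Λ ∈ P.rootSpan ℤ := by
    by_contra hn
    exact hμ (wspL_eq_bot_of_notMem S _ hn)
  obtain ⟨m, hm⟩ := Int.eq_ofNat_of_zero_le (hdom s hs)
  have h1 := wspL_reflect_ne_bot S Λ ⟨s, hs⟩ hm hyQ hμ
  rw [mem_wtSet_iff]
  convert h1 using 2
  rw [add_sub_cancel, RootPairing.reflection_apply]
  change μ - (P.toLinearMap μ (P.coroot s)) • P.root s - Λ = _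
  abel

/-- **`L(Λ)` has finitely many weights** for dominant `Λ` (weights below `Λ`, stable under the
simple reflections: `RootDatumWeights.finite_of_forall_reflection_mem`). [folklore] -/
theorem wtSet_finite [IsAlgClosed k] (hdom : RootDatumWeights.IsDominant P b Λ) : (wtSet S Λ).Finite :=
  RootDatumWeights.finite_of_forall_reflection_mem P b Λ
    (fun _ hμ => exists_eq_sub_of_mem_wtSet S Λ hμ)
    (fun _ hs _ hμ => reflection_mem_wtSet S Λ hdom hs hμ)

/-- **`L(Λ)` is finite-dimensional for dominant `Λ ∈ X`** (finitely many weights, each weight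
space finite-dimensional; Humphreys Theorem 21.2). [folklore] -/
theorem finiteDimensional_irr [IsAlgClosed k] (hdom : RootDatumWeights.IsDominant P b Λ) :
    FiniteDimensional k (Irr S (xChar b k Λ)) := by
  have hfin := wtSet_finite S Λ hdom
  set T : Finset X := hfin.toFinset with hT
  have htop : (⊤ : Submodule k (Irr S (xChar b k Λ))) ≤ ⨆ μ : T, wspL S (xChar b k Λ) ((μ : X) - Λ) := by
    rw [← iSup_wspL_eq_top S]
    refine iSup_le fun y => ?_
    by_cases hy : wspL S (xChar b k Λ) y = ⊥
    · rw [hy]; exact bot_le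
    · have hmem : Λ + y ∈ T := by
        rw [hT, Set.Finite.mem_toFinset, mem_wtSet_iff, add_sub_cancel_left]
        exact hy
      exact le_iSup_of_le ⟨Λ + y, hmem⟩ (by rw [add_sub_cancel_left])
  haveI : FiniteDimensional k (⨆ μ : T, wspL S (xChar b k Λ) ((μ : X) - Λ) :) :=
    Submodule.finiteDimensional_iSup _
  have heq : (⨆ μ : T, wspL S (xChar b k Λ) ((μ : X) - Λ)) = ⊤ := eq_top_iff.2 htop
  have htop' : FiniteDimensional k (⊤ : Submodule k (Irr S (xChar b k Λ))) := by
    rw [← heq]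
    infer_instance
  exact LinearEquiv.finiteDimensional (Submodule.topEquiv : (⊤ : Submodule k (Irr S (xChar b k Λ))) ≃ₗ[k] _)

end LocalFinite

end Dominant

end System

end ChevalleyVerma

end Literature.NumberTheory.Automorphic
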